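import Summits.AtomisticToContinuum.Crystallization.Theorems.DisclinationRationBarlowLiouvilleTrivialPrice
import Summits.AtomisticToContinuum.Crystallization.Theorems.HullExactificationCascadeHullBulkOptimalCut
import Literature.MathematicalPhysics.StatisticalMechanics.LocalMatchingCompactness
import Literature.MathematicalPhysics.StatisticalMechanics.TwoScaleShellSums

/-!
# Crux `BarlowLiouville` (stmt-AtomisticToContinuum-15801), line `Sketch` — stub `stub_fluxBookkeeping`

The BOUNDARY FLUX OF A DOMINATED ANTISYMMETRIC TRANSFER (registered stub `stub_fluxBookkeeping` of the
lead skeleton `DisclinationRationBarlowLiouville`, rev 6). For a `δ`-separated `X ⊆ ℝ³` and an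
antisymmetric `τ : ℝ³ → ℝ³ → ℝ` with `|τ y z| ≤ M · dist(y,z)⁻⁶` on `X`, the total transfer out of the
points of `X` in a closed ball is `O((L+1)²)`:
`|Σ_{y ∈ X ∩ B̄_L(ctr)} Σ'_{z ∈ X, z ≠ y} τ y z| ≤ C (L+1)²` for all `ctr, L`.

Proof ("only the boundary flux of a null Lagrangian survives summation"): `W = X ∩ B̄_L(ctr)` is finite
(`finite_of_forall_le_dist_of_subset_closedBall`); every site sum splits as the finite sum over
`W ∖ {y}` plus the tail over `X ∖ W` (`tsum_site_eq_sum_erase_add_tsum`); the pairs inside `W` cancel by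
antisymmetry (`sum_sum_erase_eq_zero_of_antisymm`); the tail at `y` is dominated by
`M · 250 δ⁻³ ρ_y⁻³`, `ρ_y = dist(y, X ∖ W) ≥ δ` (`sum_inv_pow_six_le_two_scale`,
`summable_and_abs_tsum_le_of_dominated`), `ρ_y⁻³ ≤ ((1+δ)/δ)³ (1 + ρ_y)⁻³`, and
`Σ_{y ∈ W} (1 + ρ_y)⁻³ ≤ 48(1+δ)δ⁻³ (L+1+δ)²` is the landed boundary functional of balls
`sum_boundaryWeight_ball_le`. No definitions. [folklore] throughout.
-/

noncomputable section

namespace Summit.AtomisticToContinuum.Crystallization.Theorems.DisclinationRationBarlowLiouville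

open scoped BigOperators Topology
open Filter Metric Literature.MathematicalPhysics.StatisticalMechanics
open Summit.AtomisticToContinuum.Crystallization.Theorems.HullBulkOptimal (tsum_finite_eq_sum)

/-- Euclidean `3`-space. -/
local notation "E3" => EuclideanSpace ℝ (Fin 3)

/-! ## Splitting a site sum at a finite set -/

/-- **Splitting a site sum at a finite set.** For `y ∈ W ⊆ X` (`W` a `Finset`) and `g` summable over
`X ∖ W`: `Σ'_{z ∈ X, z ≠ y} g z = Σ_{z ∈ W.erase y} g z + Σ'_{z ∈ X ∖ W} g z`. [folklore] -/
theorem tsum_site_eq_sum_erase_add_tsum {X : Set E3} {W : Finset E3} (hWX : (↑W : Set E3) ⊆ X)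
    {y : E3} (hy : y ∈ W) (g : E3 → ℝ) (hsum : Summable fun z : ↥(X \ (↑W : Set E3)) => g z) :
    ∑' z : ↥({z : E3 | z ∈ X ∧ z ≠ y} : Set E3), g z =
      ∑ z ∈ W.erase y, g z + ∑' z : ↥(X \ (↑W : Set E3)), g z := by
  -- adapted from `PalmUnimodularRigidityMinimiserShellsEquilibriumInLawCluster.tsum_sdiff_coe_eq_sum_add_tsum`
  classical
  have hsplit : ({z : E3 | z ∈ X ∧ z ≠ y} : Set E3) = ↑(W.erase y) ∪ (X \ (↑W : Set E3)) := by
    ext z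
    simp only [Set.mem_setOf_eq, Finset.coe_erase, Set.mem_union, Set.mem_sdiff, Finset.mem_coe,
      Set.mem_singleton_iff]
    constructor
    · rintro ⟨hzX, hzy⟩
      by_cases hzW : z ∈ W
      · exact Or.inl ⟨hzW, hzy⟩
      · exact Or.inr ⟨hzX, hzW⟩
    · rintro (⟨hzW, hzy⟩ | ⟨hzX, hzW⟩)
      · exact ⟨hWX hzW, hzy⟩
      · exact ⟨hzX, fun hzy => hzW (hzy ▸ hy)⟩
  have hdisj : Disjoint (↑(W.erase y) : Set E3) (X \ (↑W : Set E3)) :=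
    Set.disjoint_left.2 fun z hz hz' => hz'.2 (Finset.mem_of_mem_erase hz)
  rw [tsum_congr_set_coe g hsplit, Summable.tsum_union_disjoint hdisj ((W.erase y).summable g) hsum,
    Finset.tsum_subtype']

/-! ## Antisymmetric kernels cancel on finite sets -/

/-- An antisymmetric kernel sums to zero over the off-diagonal pairs of a finite set:
`Σ_{y ∈ W} Σ_{z ∈ W.erase y} τ y z = 0` (`τ y y = 0`, then `Finset.sum_comm`). [folklore] -/
theorem sum_sum_erase_eq_zero_of_antisymm (W : Finset E3) (τ : E3 → E3 → ℝ)
    (hanti : ∀ y z : E3, τ y z = -τ z y) : ∑ y ∈ W, ∑ z ∈ W.erase y, τ y z = 0 := by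
  classical
  have hdiag : ∀ y : E3, τ y y = 0 := fun y => by linarith [hanti y y]
  have h1 : ∑ y ∈ W, ∑ z ∈ W.erase y, τ y z = ∑ y ∈ W, ∑ z ∈ W, τ y z :=
    Finset.sum_congr rfl fun y _ => Finset.sum_erase W (hdiag y)
  have h2 : ∑ y ∈ W, ∑ z ∈ W, τ y z = -∑ y ∈ W, ∑ z ∈ W, τ y z :=
    calc ∑ y ∈ W, ∑ z ∈ W, τ y z = ∑ y ∈ W, ∑ z ∈ W, -τ z y :=
          Finset.sum_congr rfl fun y _ => Finset.sum_congr rfl fun z _ => hanti y z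
      _ = -∑ y ∈ W, ∑ z ∈ W, τ z y := by simp only [Finset.sum_neg_distrib]
      _ = -∑ y ∈ W, ∑ z ∈ W, τ y z := by rw [Finset.sum_comm]
  rw [h1]
  linarith

/-! ## Dominated tails over far separated sets -/

/-- **Dominated tail over a far separated set.** If `S ⊆ ℝ³` is `δ`-separated, all its points are at
distance `≥ ρ ≥ δ > 0` from `y`, and `|g z| ≤ M' · dist(y,z)⁻⁶` on `S` with `M' ≥ 0`, then `g` is summable
over `S` and `|Σ'_{z ∈ S} g z| ≤ M' · 250 δ⁻³ ρ⁻³` (finite partial sums of the majorant are bounded by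
`sum_inv_pow_six_le_two_scale`). [folklore] -/
theorem summable_and_abs_tsum_le_of_dominated {S : Set E3} {δ ρ M' : ℝ} (hδ : 0 < δ) (hδρ : δ ≤ ρ)
    (hM' : 0 ≤ M') (hsep : ∀ z ∈ S, ∀ w ∈ S, z ≠ w → δ ≤ dist z w) {y : E3}
    (hfar : ∀ z ∈ S, ρ ≤ dist y z) (g : E3 → ℝ) (hg : ∀ z ∈ S, |g z| ≤ M' * (dist y z)⁻¹ ^ 6) :
    Summable (fun z : ↥S => g z) ∧ |∑' z : ↥S, g z| ≤ M' * (250 * δ⁻¹ ^ 3 * ρ⁻¹ ^ 3) := by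
  classical
  have hbd : ∀ u : Finset ↥S, ∑ z ∈ u, M' * (dist y (z : E3))⁻¹ ^ 6 ≤
      M' * (250 * δ⁻¹ ^ 3 * ρ⁻¹ ^ 3) := by
    intro u
    rw [← Finset.mul_sum]
    refine mul_le_mul_of_nonneg_left ?_ hM'
    have h := sum_inv_pow_six_le_two_scale (u.image Subtype.val) y hδ hδρ ?_ ?_
    · rwa [Finset.sum_image fun a _ b _ h => Subtype.ext h] at h
    · intro a ha b hb hab
      obtain ⟨a', -, rfl⟩ := Finset.mem_image.1 ha
      obtain ⟨b', -, rfl⟩ := Finset.mem_image.1 hb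
      exact hsep _ a'.2 _ b'.2 hab
    · intro a ha
      obtain ⟨a', -, rfl⟩ := Finset.mem_image.1 ha
      exact hfar _ a'.2
  have hmaj : Summable fun z : ↥S => M' * (dist y (z : E3))⁻¹ ^ 6 :=
    summable_of_sum_le (fun _ => by positivity) hbd
  have hle : ∀ z : ↥S, ‖g z‖ ≤ M' * (dist y (z : E3))⁻¹ ^ 6 := fun z => by
    rw [Real.norm_eq_abs]
    exact hg _ z.2
  refine ⟨Summable.of_norm_bounded hmaj hle, ?_⟩
  have h1 : ‖∑' z : ↥S, g z‖ ≤ ∑' z : ↥S, M' * (dist y (z : E3))⁻¹ ^ 6 :=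
    tsum_of_norm_bounded hmaj.hasSum hle
  rw [Real.norm_eq_abs] at h1
  exact h1.trans (hmaj.tsum_le_of_sum_le hbd)

/-! ## The flux bound for a given finite window -/

/-- **Boundary flux, `Finset` form.** For a `δ`-separated `X ⊆ ℝ³`, an antisymmetric `τ` with
`|τ y z| ≤ M' · dist(y,z)⁻⁶` on `X` (`M' ≥ 0`), a centre `ctr`, a radius `L` and the finite set
`W = X ∩ B̄_L(ctr)` (given as a `Finset` with its membership characterisation):
`|Σ_{y ∈ W} Σ'_{z ∈ X, z ≠ y} τ y z| ≤ M' · 250 δ⁻³ ((1+δ)/δ)³ · 48(1+δ)δ⁻³ · (1+δ)² · (L+1)²`.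
[folklore] -/
theorem abs_sum_tsum_transfer_le {δ : ℝ} (hδ : 0 < δ) {X : Set E3}
    (hsep : ∀ y ∈ X, ∀ z ∈ X, y ≠ z → δ ≤ dist y z) {M' : ℝ} (hM' : 0 ≤ M') (τ : E3 → E3 → ℝ)
    (hanti : ∀ y z : E3, τ y z = -τ z y)
    (hdom : ∀ y ∈ X, ∀ z ∈ X, y ≠ z → |τ y z| ≤ M' * (dist y z)⁻¹ ^ 6)
    (ctr : E3) (L : ℝ) (W : Finset E3) (hW : ∀ p, p ∈ W ↔ p ∈ X ∧ dist p ctr ≤ L) :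
    |∑ y ∈ W, ∑' z : ↥({z : E3 | z ∈ X ∧ z ≠ y} : Set E3), τ y (z : E3)| ≤
      M' * (250 * δ⁻¹ ^ 3 * ((1 + δ) / δ) ^ 3) * (48 * (1 + δ) / δ ^ 3) * (1 + δ) ^ 2
        * (L + 1) ^ 2 := by
  classical
  set K : ℝ := M' * (250 * δ⁻¹ ^ 3 * ((1 + δ) / δ) ^ 3) with hK
  have hK0 : 0 ≤ K := by positivity
  have hC0 : 0 ≤ K * (48 * (1 + δ) / δ ^ 3) * (1 + δ) ^ 2 * (L + 1) ^ 2 := by positivity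
  have hWX : (↑W : Set E3) ⊆ X := fun p hp => ((hW p).1 hp).1
  -- the outside of the ball
  set T : Set E3 := X \ (↑W : Set E3) with hT
  have hTsep : ∀ z ∈ T, ∀ w ∈ T, z ≠ w → δ ≤ dist z w := fun z hz w hw hzw => hsep z hz.1 w hw.1 hzw
  have hyT : ∀ y ∈ W, ∀ z ∈ T, y ≠ z := fun y hy z hz h => hz.2 (h ▸ hy)
  by_cases hne : T.Nonempty
  · -- depth `ρ_y = dist(y, T) ≥ δ`
    have hρ : ∀ y ∈ W, δ ≤ infDist y T := by
      intro y hy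
      rw [le_infDist hne]
      intro z hz
      exact hsep y (hWX hy) z hz.1 (hyT y hy z hz)
    have htail : ∀ y ∈ W, Summable (fun z : ↥T => τ y z) ∧
        |∑' z : ↥T, τ y z| ≤ M' * (250 * δ⁻¹ ^ 3 * (infDist y T)⁻¹ ^ 3) := fun y hy =>
      summable_and_abs_tsum_le_of_dominated hδ (hρ y hy) hM' hTsep
        (fun z hz => infDist_le_dist_of_mem hz) (τ y)
        (fun z hz => hdom y (hWX hy) z hz.1 (hyT y hy z hz))
    have hsplit : ∀ y ∈ W, ∑' z : ↥({z : E3 | z ∈ X ∧ z ≠ y} : Set E3), τ y (z : E3) =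
        ∑ z ∈ W.erase y, τ y z + ∑' z : ↥T, τ y z := fun y hy =>
      tsum_site_eq_sum_erase_add_tsum hWX hy (τ y) (htail y hy).1
    rw [Finset.sum_congr rfl hsplit, Finset.sum_add_distrib, sum_sum_erase_eq_zero_of_antisymm W τ hanti,
      zero_add]
    -- sitewise weight
    have hw : ∀ y ∈ W, |∑' z : ↥T, τ y z| ≤ K * (1 + infDist y T)⁻¹ ^ 3 := by
      intro y hy
      refine (htail y hy).2.trans ?_
      have hρ0 : 0 < infDist y T := hδ.trans_le (hρ y hy)
      have h1 : (infDist y T)⁻¹ ≤ (1 + δ) / δ * (1 + infDist y T)⁻¹ := by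
        rw [inv_eq_one_div, inv_eq_one_div, div_mul_div_comm, mul_one,
          div_le_div_iff₀ hρ0 (by positivity)]
        nlinarith [hρ y hy]
      have h2 : (infDist y T)⁻¹ ^ 3 ≤ ((1 + δ) / δ) ^ 3 * (1 + infDist y T)⁻¹ ^ 3 := by
        rw [← mul_pow]
        exact pow_le_pow_left₀ (inv_nonneg.2 hρ0.le) h1 3
      calc M' * (250 * δ⁻¹ ^ 3 * (infDist y T)⁻¹ ^ 3)
          ≤ M' * (250 * δ⁻¹ ^ 3 * (((1 + δ) / δ) ^ 3 * (1 + infDist y T)⁻¹ ^ 3)) :=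
            mul_le_mul_of_nonneg_left (mul_le_mul_of_nonneg_left h2 (by positivity)) hM'
        _ = K * (1 + infDist y T)⁻¹ ^ 3 := by rw [hK]; ring
    have hbd := sum_boundaryWeight_ball_le hδ hsep ctr L W hW hne
    -- `W ≠ ∅` gives `L ≥ 0`
    by_cases hW0 : W = ∅
    · rw [hW0, Finset.sum_empty, abs_zero]
      exact hC0
    obtain ⟨p₀, hp₀⟩ := Finset.nonempty_iff_ne_empty.2 hW0
    have hL : 0 ≤ L := dist_nonneg.trans ((hW p₀).1 hp₀).2
    have h2 : (L + 1 + δ) ^ 2 ≤ (1 + δ) ^ 2 * (L + 1) ^ 2 := by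
      have : L + 1 + δ ≤ (1 + δ) * (L + 1) := by nlinarith
      have h0 : 0 ≤ L + 1 + δ := by linarith
      calc (L + 1 + δ) ^ 2 ≤ ((1 + δ) * (L + 1)) ^ 2 := pow_le_pow_left₀ h0 this 2
        _ = (1 + δ) ^ 2 * (L + 1) ^ 2 := by ring
    calc |∑ y ∈ W, ∑' z : ↥T, τ y z| ≤ ∑ y ∈ W, |∑' z : ↥T, τ y z| :=
          Finset.abs_sum_le_sum_abs _ _
      _ ≤ ∑ y ∈ W, K * (1 + infDist y T)⁻¹ ^ 3 := Finset.sum_le_sum hw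
      _ = K * ∑ y ∈ W, (1 + infDist y T)⁻¹ ^ 3 := by rw [Finset.mul_sum]
      _ ≤ K * (48 * (1 + δ) / δ ^ 3 * (L + 1 + δ) ^ 2) := mul_le_mul_of_nonneg_left hbd hK0
      _ ≤ K * (48 * (1 + δ) / δ ^ 3 * ((1 + δ) ^ 2 * (L + 1) ^ 2)) :=
          mul_le_mul_of_nonneg_left (mul_le_mul_of_nonneg_left h2 (by positivity)) hK0
      _ = K * (48 * (1 + δ) / δ ^ 3) * (1 + δ) ^ 2 * (L + 1) ^ 2 := by ring
  · -- `X ⊆ W`: no tail at all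
    have hT0 : T = ∅ := Set.not_nonempty_iff_eq_empty.1 hne
    haveI : IsEmpty ↥T := Set.isEmpty_coe_sort.2 hT0
    have hsplit : ∀ y ∈ W, ∑' z : ↥({z : E3 | z ∈ X ∧ z ≠ y} : Set E3), τ y (z : E3) =
        ∑ z ∈ W.erase y, τ y z + ∑' z : ↥T, τ y z := fun y hy =>
      tsum_site_eq_sum_erase_add_tsum hWX hy (τ y) (hasSum_empty.summable)
    rw [Finset.sum_congr rfl hsplit, Finset.sum_add_distrib, sum_sum_erase_eq_zero_of_antisymm W τ hanti,
      zero_add, Finset.sum_congr rfl fun y _ => (tsum_empty : ∑' z : ↥T, τ y z = 0),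
      Finset.sum_const_zero, abs_zero]
    exact hC0

/-! ## The registered stub -/

/-- STUB F (M, bookkeeping) — **BOUNDARY FLUX OF A DOMINATED ANTISYMMETRIC TRANSFER.** For a
`δ`-separated `X ⊆ ℝ³` and an antisymmetric `τ` with `|τ y z| ≤ M · dist(y,z)⁻⁶` on `X`, the total
transfer out of the points of `X` in a closed ball is `O((L+1)²)`:
`|Σ_{y ∈ X ∩ B̄_L(ctr)} Σ'_{z ∈ X, z ≠ y} τ y z| ≤ C (L+1)²` for all `ctr, L` (the pairs inside the ball
cancel by antisymmetry; the pairs across the sphere are dominated by `M · 250 δ⁻³ Σ_y ρ_y⁻³`,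
`ρ_y = dist(y, X ∖ B̄_L) ≥ δ`, and `Σ_y (1 + ρ_y)⁻³ ≤ 48(1+δ)δ⁻³ (L+1+δ)²` is the boundary functional of
balls `sum_boundaryWeight_ball_le`). [folklore] -/
theorem stub_fluxBookkeeping :
    ∀ δ : ℝ, 0 < δ → ∀ X : Set E3, (∀ y ∈ X, ∀ z ∈ X, y ≠ z → δ ≤ dist y z) →
    ∀ (M : ℝ) (τ : E3 → E3 → ℝ), (∀ y z : E3, τ y z = -τ z y) →
    (∀ y ∈ X, ∀ z ∈ X, y ≠ z → |τ y z| ≤ M * (dist y z)⁻¹ ^ 6) →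
    ∃ C : ℝ, ∀ (ctr : E3) (L : ℝ),
      |∑' y : ↥{y : E3 | y ∈ X ∧ dist y ctr ≤ L},
          ∑' z : ↥{z : E3 | z ∈ X ∧ z ≠ (y : E3)}, τ (y : E3) (z : E3)| ≤ C * (L + 1) ^ 2 := by
  intro δ hδ X hsep M τ hanti hdom
  have hM' : 0 ≤ max M 0 := le_max_right _ _
  have hdom' : ∀ y ∈ X, ∀ z ∈ X, y ≠ z → |τ y z| ≤ max M 0 * (dist y z)⁻¹ ^ 6 :=
    fun y hy z hz hyz =>
      (hdom y hy z hz hyz).trans (mul_le_mul_of_nonneg_right (le_max_left _ _) (by positivity))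
  refine ⟨max M 0 * (250 * δ⁻¹ ^ 3 * ((1 + δ) / δ) ^ 3) * (48 * (1 + δ) / δ ^ 3) * (1 + δ) ^ 2,
    fun ctr L => ?_⟩
  set Wset : Set E3 := {y : E3 | y ∈ X ∧ dist y ctr ≤ L} with hWset
  have hfin : Wset.Finite :=
    finite_of_forall_le_dist_of_subset_closedBall hδ
      (fun p hp q hq hpq => hsep p hp.1 q hq.1 hpq) (c := ctr) (R := L)
      (fun p hp => mem_closedBall.2 hp.2)
  have hWf : ∀ p, p ∈ hfin.toFinset ↔ p ∈ X ∧ dist p ctr ≤ L := fun p => by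
    rw [Set.Finite.mem_toFinset]
    rfl
  have htsum : (∑' y : ↥Wset, ∑' z : ↥{z : E3 | z ∈ X ∧ z ≠ (y : E3)}, τ (y : E3) (z : E3))
      = ∑ y ∈ hfin.toFinset, ∑' z : ↥{z : E3 | z ∈ X ∧ z ≠ y}, τ y (z : E3) :=
    tsum_finite_eq_sum hfin (fun y => ∑' z : ↥{z : E3 | z ∈ X ∧ z ≠ y}, τ y (z : E3))
  rw [htsum]
  exact abs_sum_tsum_transfer_le hδ hsep hM' τ hanti hdom' ctr L hfin.toFinset hWf

end Summit.AtomisticToContinuum.Crystallization.Theorems.DisclinationRationBarlowLiouville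

end
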